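import Literature.NumberTheory.Automorphic.OrbitalMeasureCanonicalAtPoint
import Literature.NumberTheory.Automorphic.OrbitalIntegralCentralTransport
import Literature.NumberTheory.Automorphic.UnitaryGroupOrbitalMeasureOfLocalQuotient
import Literature.NumberTheory.Automorphic.UnitaryGroupOfLocalCovolumeStableKit
import HarnessLib

/-!
# Regular orbital integrals are locally constant in chart coordinates (generic layer, non-archimedean)

Topic `NumberTheory/Automorphic`; namespace `Literature.NumberTheory.Automorphic`. THEOREMS ONLY (no definition, no instance, no notation, no named
fact, no `sorry`). Cell `pub/hodgecm-mathlib`, programme P3a, road «N6-ns» (the non-split clause of letter N6), brick **N6ns-reg-(ii)** (LEAD T8-2 (3)),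
GENERIC totally-disconnected-group layer; the unitary dress (Cayley chart of A-p16's chart-3) is a separate file.

THE MATHEMATICS. `G` a topological group, `T ≤ G` («the torus», `T = Z(γ)`), `V ⊆ G` a set of torus points centralised by `T`
(`∀ t ∈ V, ∀ τ ∈ T, τ t = t τ`), `S ⊆ G` a «slice» and `Ω ⊆ G` the «chart image». Two hypotheses make the orbital integral
`O_t(f) = ∫_{G ⧸ T} f(x t x⁻¹) dμ(ẋ)` CHART-LOCAL for `t ∈ V`:
* (SAT) chart saturation `x t x⁻¹ ∈ Ω ⇒ x ∈ S·T` (in the dress: injectivity of the chart + Weyl separation near a regular `γ`);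
* `supp f ⊆ Ω`.
Then the integrand `ẋ ↦ f(x t x⁻¹)` vanishes off `π(S)` and on `π(S)` only the values `f(s t s⁻¹)`, `s ∈ S`, enter (`(sτ) t (sτ)⁻¹ = s t s⁻¹`). Hence:
* §1 `descConj_eq_descConj_of_forall_conj_eq` ∕ `integral_descConj_eq_of_forall_conj_eq`: if `f(s t s⁻¹) = f(s t₀ s⁻¹)` for all `s ∈ S` then the
  two integrands AGREE POINTWISE, so `O_t(f) = O_{t₀}(f)` for ANY measure `μ` on `G ⧸ T`; `integral_descConj_eq_measureReal_smul_of_forall_conj_eq`: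
  if `f(s t s⁻¹) = c` for all `s ∈ S` («`f ∘ chart = 1_U ⊗ g`») then `O_t(f) = μ(π(S)) • c` («vol × g(t)», vol = the measure of the slice image, `t`-free).
* §2 `exists_nhds_forall_eq_of_isLocallyConstant` (tube lemma): a locally constant `F : A × B → Y` is, on a compact `K ⊆ A`, UNIFORMLY constant in
  the second variable near `b₀` — this turns «`f ∘ chart` locally constant» into the hypothesis of §1.
* §3 the CANONICAL-FAMILY reading (★ `OrbitalMeasureFamily.IsCanonical`, ★ D-S1g `classOrbitalIntegral_mk_eq_orbitalIntegral'`): for a closed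
  `T` with `Z(t) = T` and a Haar inversion-invariant `ρ` on `T` of compact-core mass one, `Φ([t], f; m) = ∫_{G⧸T} f(x t x⁻¹) d(ν∕ρ)`
  (`classOrbitalIntegral_mk_eq_integral_descConj_of_centralizer_eq`, transport at `MulEquiv.refl` ★ `integral_descConj_quotientMeasure_eq_of_mulEquiv`
  + Haar uniqueness under compact-core mass one ★ `eq_of_apply_compactCore_eq_one`), whence the headline
  `classOrbitalIntegral_mk_eq_of_forall_conj_eq`: `Φ([t], f; m) = Φ([t₀], f; m)` for `t, t₀ ∈ V` under (SAT), `supp f ⊆ Ω` and `f(s t s⁻¹) = f(s t₀ s⁻¹)`,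
  and the «vol × c» formula `classOrbitalIntegral_mk_eq_measureReal_smul_of_forall_conj_eq`.
NOT here: the chart (★ A-p16 `exists_openPartialHomeomorph_conjOrbit`, chart-3), the Weyl separation discharging (SAT), Harish-Chandra's uniform
compactness for test functions not supported in a chart image, the glue (iii).

## References
* [HarishChandra1970] Harish-Chandra (notes by G. van Dijk), *Harmonic Analysis on Reductive p-adic Groups*, LNM 162 (1970), Part I §3, Lemma 13 ff.
* [Rogawski1990] J. D. Rogawski, *Automorphic Representations of Unitary Groups in Three Variables*, Ann. of Math. Stud. 123 (1990), §4.3 p. 43; §4.9 p. 54.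
* [DeitmarEchterhoff2014] A. Deitmar, S. Echterhoff, *Principles of Harmonic Analysis*, 2nd ed. (2014), Thm. 1.5.3.
-/

set_option autoImplicit false

noncomputable section

open MeasureTheory Measure Set Filter Topology Literature.MeasureTheory.Group
open scoped ENNReal NNReal Pointwise

namespace Literature.NumberTheory.Automorphic

/-! ## §1 Chart-local orbital integrands: pointwise comparison on `G ⧸ T` -/

section Pointwise

variable {G : Type*} [Group G] {T : Subgroup G} {E : Type*}

/-- **Conjugating by `s τ`, `τ ∈ T ⊆ Z(t)`, is conjugating by `s`.** [cite: HarishChandra1970, Part I §3] -/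
theorem mul_mul_conj_eq_of_comm {s τ t : G} (hτ : τ * t = t * τ) : s * τ * t * (s * τ)⁻¹ = s * t * s⁻¹ := by
  have h : s * τ * t = s * t * τ := by rw [mul_assoc, hτ, ← mul_assoc]
  rw [mul_inv_rev, h]
  simp only [mul_assoc, mul_inv_cancel_left]

/-- **THE CHART-LOCAL ORBITAL INTEGRANDS AGREE POINTWISE.** With `V` centralised by `T`, chart saturation `x t x⁻¹ ∈ Ω ⇒ x ∈ S·T` on `V`,
`f = 0` off `Ω` and `f(s t s⁻¹) = f(s t₀ s⁻¹)` for `s ∈ S` (`t, t₀ ∈ V`): `ẋ ↦ f(x t x⁻¹)` and `ẋ ↦ f(x t₀ x⁻¹)` are the SAME function on `G ⧸ T`.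
[cite: HarishChandra1970, Part I §3] [cite: Rogawski1990, §4.9 p. 54] -/
theorem descConj_eq_descConj_of_forall_conj_eq (S Ω V : Set G) (hV : ∀ t ∈ V, ∀ τ ∈ T, τ * t = t * τ)
    (hsat : ∀ t ∈ V, ∀ x : G, x * t * x⁻¹ ∈ Ω → x ∈ S * (T : Set G))
    {f : G → E} [Zero E] (hf : ∀ y ∉ Ω, f y = 0) {t t₀ : G} (ht : t ∈ V) (ht₀ : t₀ ∈ V)
    (hconst : ∀ s ∈ S, f (s * t * s⁻¹) = f (s * t₀ * s⁻¹)) :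
    descConj t T (hV t ht) f = descConj t₀ T (hV t₀ ht₀) f := by
  funext x
  induction x using QuotientGroup.induction_on with
  | H g =>
    rw [descConj_mk, descConj_mk]
    by_cases hg : g ∈ S * (T : Set G)
    · obtain ⟨s, hs, τ, hτ, rfl⟩ := Set.mem_mul.1 hg
      rw [mul_mul_conj_eq_of_comm (hV t ht τ hτ), mul_mul_conj_eq_of_comm (hV t₀ ht₀ τ hτ)]
      exact hconst s hs
    · rw [hf _ fun h => hg (hsat t ht g h), hf _ fun h => hg (hsat t₀ ht₀ g h)]

/-- **`O_t(f) = O_{t₀}(f)` for ANY measure on `G ⧸ T`** under the hypotheses of ★ `descConj_eq_descConj_of_forall_conj_eq`.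
[cite: HarishChandra1970, Part I §3] [cite: Rogawski1990, §4.9 p. 54] -/
theorem integral_descConj_eq_of_forall_conj_eq [NormedAddCommGroup E] [NormedSpace ℝ E] [MeasurableSpace (G ⧸ T)] (μ : Measure (G ⧸ T))
    (S Ω V : Set G) (hV : ∀ t ∈ V, ∀ τ ∈ T, τ * t = t * τ)
    (hsat : ∀ t ∈ V, ∀ x : G, x * t * x⁻¹ ∈ Ω → x ∈ S * (T : Set G))
    {f : G → E} (hf : ∀ y ∉ Ω, f y = 0) {t t₀ : G} (ht : t ∈ V) (ht₀ : t₀ ∈ V)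
    (hconst : ∀ s ∈ S, f (s * t * s⁻¹) = f (s * t₀ * s⁻¹)) :
    ∫ x, descConj t T (hV t ht) f x ∂μ = ∫ x, descConj t₀ T (hV t₀ ht₀) f x ∂μ := by
  rw [descConj_eq_descConj_of_forall_conj_eq S Ω V hV hsat hf ht ht₀ hconst]

/-- **The chart-local orbital integrand of a box product is an indicator**: if `f(s t s⁻¹) = c` for all `s ∈ S` (and (SAT), `f = 0` off `Ω`),
then `ẋ ↦ f(x t x⁻¹)` is `c · 1_{π(S)}` on `G ⧸ T`. [cite: HarishChandra1970, Part I §3] -/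
theorem descConj_eq_indicator_of_forall_conj_eq (S Ω V : Set G) (hV : ∀ t ∈ V, ∀ τ ∈ T, τ * t = t * τ)
    (hsat : ∀ t ∈ V, ∀ x : G, x * t * x⁻¹ ∈ Ω → x ∈ S * (T : Set G))
    {f : G → E} [Zero E] (hf : ∀ y ∉ Ω, f y = 0) {t : G} (ht : t ∈ V) {c : E} (hprod : ∀ s ∈ S, f (s * t * s⁻¹) = c) :
    descConj t T (hV t ht) f = (QuotientGroup.mk '' S : Set (G ⧸ T)).indicator fun _ => c := by
  funext x
  induction x using QuotientGroup.induction_on with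
  | H g =>
    rw [descConj_mk]
    by_cases hg : g ∈ S * (T : Set G)
    · obtain ⟨s, hs, τ, hτ, rfl⟩ := Set.mem_mul.1 hg
      have hmem : (QuotientGroup.mk (s * τ) : G ⧸ T) ∈ (QuotientGroup.mk '' S : Set (G ⧸ T)) :=
        ⟨s, hs, (QuotientGroup.mk_mul_of_mem s hτ).symm⟩
      rw [Set.indicator_of_mem hmem, mul_mul_conj_eq_of_comm (hV t ht τ hτ)]
      exact hprod s hs
    · have hnot : (QuotientGroup.mk g : G ⧸ T) ∉ (QuotientGroup.mk '' S : Set (G ⧸ T)) := by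
        rintro ⟨s, hs, hsg⟩
        rw [QuotientGroup.eq] at hsg
        exact hg (Set.mem_mul.2 ⟨s, hs, s⁻¹ * g, hsg, mul_inv_cancel_left s g⟩)
      rw [Set.indicator_of_notMem hnot]
      exact hf _ fun h => hg (hsat t ht g h)

/-- **«vol × g(t)»**: under (SAT), `f = 0` off `Ω` and `f(s t s⁻¹) = c` for `s ∈ S`, `O_t(f) = μ(π(S)) • c` for ANY measure `μ` on `G ⧸ T` with
`π(S)` measurable — the volume of the slice image does not depend on `t`. [cite: HarishChandra1970, Part I §3] [cite: Rogawski1990, §4.9 p. 54] -/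
theorem integral_descConj_eq_measureReal_smul_of_forall_conj_eq [NormedAddCommGroup E] [NormedSpace ℝ E] [CompleteSpace E] [MeasurableSpace (G ⧸ T)]
    (μ : Measure (G ⧸ T)) (S Ω V : Set G) (hV : ∀ t ∈ V, ∀ τ ∈ T, τ * t = t * τ)
    (hsat : ∀ t ∈ V, ∀ x : G, x * t * x⁻¹ ∈ Ω → x ∈ S * (T : Set G))
    {f : G → E} (hf : ∀ y ∉ Ω, f y = 0) {t : G} (ht : t ∈ V) {c : E} (hprod : ∀ s ∈ S, f (s * t * s⁻¹) = c)
    (hSm : MeasurableSet (QuotientGroup.mk '' S : Set (G ⧸ T))) :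
    ∫ x, descConj t T (hV t ht) f x ∂μ = μ.real (QuotientGroup.mk '' S : Set (G ⧸ T)) • c := by
  rw [descConj_eq_indicator_of_forall_conj_eq S Ω V hV hsat hf ht hprod]
  exact integral_indicator_const c hSm

end Pointwise

/-! ## §2 The tube lemma: locally constant in two variables is uniformly constant in the second one over a compact set -/

section Tube

variable {A B Y : Type*} [TopologicalSpace A] [TopologicalSpace B]

/-- **Tube lemma for locally constant functions**: `F : A × B → Y` locally constant, `K ⊆ A` compact, `b₀ ∈ B` ⇒ there is a neighbourhood `W` of
`b₀` with `F(a, b) = F(a, b₀)` for all `a ∈ K`, `b ∈ W` (boxes of constancy around `K × {b₀}` + Mathlib `generalized_tube_lemma`).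
[cite: HarishChandra1970, Part I §3] -/
theorem exists_nhds_forall_eq_of_isLocallyConstant (F : A × B → Y) (hF : IsLocallyConstant F) {K : Set A} (hK : IsCompact K) (b₀ : B) :
    ∃ W ∈ 𝓝 b₀, ∀ a ∈ K, ∀ b ∈ W, F (a, b) = F (a, b₀) := by
  classical
  -- boxes of constancy around each `(a, b₀)`
  have hbox : ∀ a : A, ∃ U : Set A, ∃ W : Set B, IsOpen U ∧ IsOpen W ∧ a ∈ U ∧ b₀ ∈ W ∧ ∀ p ∈ U ×ˢ W, F p = F (a, b₀) := fun a => by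
    have hO : IsOpen (F ⁻¹' {F (a, b₀)}) := hF.isOpen_fiber _
    obtain ⟨U, W, hU, hW, haU, hbW, hUW⟩ := isOpen_prod_iff.1 hO a b₀ rfl
    exact ⟨U, W, hU, hW, haU, hbW, fun p hp => hUW hp⟩
  choose U W hU hW haU hbW hUW using hbox
  -- the open neighbourhood `N = ⋃_a U a ×ˢ W a` of `K × {b₀}` on which `F p = F (p.1, b₀)`
  have hN : IsOpen (⋃ a, U a ×ˢ W a) := isOpen_iUnion fun a => (hU a).prod (hW a)
  have hKN : K ×ˢ ({b₀} : Set B) ⊆ ⋃ a, U a ×ˢ W a := by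
    rintro ⟨a, b⟩ ⟨-, hb⟩
    rw [Set.mem_singleton_iff] at hb
    subst hb
    exact Set.mem_iUnion.2 ⟨a, haU a, hbW a⟩
  have hconstN : ∀ p ∈ ⋃ a, U a ×ˢ W a, F p = F (p.1, b₀) := by
    rintro ⟨a', b⟩ hp
    obtain ⟨a, hpa⟩ := Set.mem_iUnion.1 hp
    rw [hUW a _ hpa, hUW a (a', b₀) ⟨hpa.1, hbW a⟩]
  obtain ⟨u, v, -, hv, hKu, hbv, huv⟩ := generalized_tube_lemma hK isCompact_singleton hN hKN
  refine ⟨v, hv.mem_nhds (hbv (Set.mem_singleton b₀)), fun a ha b hb => ?_⟩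
  exact hconstN (a, b) (huv ⟨hKu ha, hb⟩)

/-- The tube lemma read through a chart `Φ : A × B → G` for a function `f` with `f ∘ Φ` locally constant: `f(Φ(a, b)) = f(Φ(a, b₀))` for `a ∈ K`
compact and `b` near `b₀`. [cite: HarishChandra1970, Part I §3] -/
theorem exists_nhds_forall_comp_eq_of_isLocallyConstant {G : Type*} (Φ : A × B → G) {f : G → Y} (hF : IsLocallyConstant (f ∘ Φ))
    {K : Set A} (hK : IsCompact K) (b₀ : B) :
    ∃ W ∈ 𝓝 b₀, ∀ a ∈ K, ∀ b ∈ W, f (Φ (a, b)) = f (Φ (a, b₀)) :=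
  exists_nhds_forall_eq_of_isLocallyConstant (f ∘ Φ) hF hK b₀

end Tube

/-! ## §3 The canonical-family reading -/

section Canonical

variable {G : Type*} [Group G] [TopologicalSpace G] [IsTopologicalGroup G] [LocallyCompactSpace G]
  [SecondCountableTopology G] [T2Space G] [MeasurableSpace G] [BorelSpace G]
  [∀ γ : G, MeasurableSpace (G ⧸ Subgroup.centralizer ({γ} : Set G))]
  [∀ γ : G, BorelSpace (G ⧸ Subgroup.centralizer ({γ} : Set G))]
  {E : Type*} [NormedAddCommGroup E] [NormedSpace ℝ E]

/-- **The orbital integral at `t` over ANY closed presentation `T = Z(t)` of the centraliser, canonical measures**: for Haar inversion-invariant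
`ρ_t` on `Z(t)` and `ρ` on `T` both of compact-core mass one, `O_t(f; ν∕ρ_t) = ∫_{G⧸T} f(x t x⁻¹) d(ν∕ρ)` (transport at `MulEquiv.refl` ★
`integral_descConj_quotientMeasure_eq_of_mulEquiv`; the transported `ρ_t` IS `ρ` by Haar uniqueness under compact-core mass one ★ `eq_of_apply_compactCore_eq_one`,
★ `map_subgroupCongrHomeomorph_apply_compactCore`). [cite: Rogawski1990, §4.3 (4.3.1) p. 43] [cite: DeitmarEchterhoff2014, Thm. 1.5.3] -/
theorem orbitalIntegral_eq_integral_descConj_of_centralizer_eq {t : G} (T : Subgroup G) (hTc : IsClosed (T : Set G))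
    [MeasurableSpace (G ⧸ T)] [BorelSpace (G ⧸ T)]
    (hT : Subgroup.centralizer ({t} : Set G) = T) (hTt : ∀ τ ∈ T, τ * t = t * τ)
    (ν : Measure G) [IsHaarMeasure ν] [ν.IsMulRightInvariant]
    (ρt : Measure ↥(Subgroup.centralizer ({t} : Set G))) [IsHaarMeasure ρt] [ρt.IsInvInvariant]
    (hρt : ρt (compactCore ↥(Subgroup.centralizer ({t} : Set G))) = 1)
    (ρ : Measure ↥T) [IsHaarMeasure ρ] [ρ.IsInvInvariant] (hρ : ρ (compactCore ↥T) = 1) (f : G → E) :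
    orbitalIntegral t f (quotientMeasure (Subgroup.centralizer ({t} : Set G)) ρt (isClosed_coe_centralizer_singleton t) ν) =
      ∫ x, descConj t T hTt f x ∂(quotientMeasure T ρ hTc ν) := by
  haveI hCc : IsClosed ((Subgroup.centralizer ({t} : Set G) : Subgroup G) : Set G) := isClosed_coe_centralizer_singleton t
  haveI : LocallyCompactSpace ↥(Subgroup.centralizer ({t} : Set G)) := hCc.isClosedEmbedding_subtypeVal.locallyCompactSpace
  haveI : LocallyCompactSpace ↥T := hTc.isClosedEmbedding_subtypeVal.locallyCompactSpace
  have hHH' : ∀ g : G, (MulEquiv.refl G) g ∈ T ↔ g ∈ Subgroup.centralizer ({t} : Set G) := fun g => by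
    rw [MulEquiv.refl_apply, hT]
  haveI : IsHaarMeasure (Measure.map (subgroupCongrHomeomorph (MulEquiv.refl G) _ _ hHH' continuous_id continuous_id) ρt) :=
    isHaarMeasure_map_subgroupCongrHomeomorph (MulEquiv.refl G) continuous_id continuous_id _ _ hHH' _
  have hρ'1 : Measure.map (subgroupCongrHomeomorph (MulEquiv.refl G) _ _ hHH' continuous_id continuous_id) ρt (compactCore ↥T) = 1 := by
    rw [map_subgroupCongrHomeomorph_apply_compactCore, hρt]
  have hρeq : ρ = Measure.map (subgroupCongrHomeomorph (MulEquiv.refl G) _ _ hHH' continuous_id continuous_id) ρt :=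
    eq_of_apply_compactCore_eq_one _ _ hρ hρ'1
  have key := integral_descConj_quotientMeasure_eq_of_mulEquiv (MulEquiv.refl G) continuous_id continuous_id
    (Subgroup.centralizer ({t} : Set G)) T hHH' ρt ρ ν ν hρeq (by simp only [MulEquiv.coe_refl, Measure.map_id])
    (γ := t) (γ' := t) rfl (fun _ hg => Subgroup.mem_centralizer_singleton_iff.1 hg) hTt f
  rw [key]
  rfl

/-- **THE CLASS ORBITAL INTEGRAL OF A CANONICAL FAMILY AT `[t]`, READ OVER `G ⧸ T` FOR ANY CLOSED `T = Z(t)` AND ANY CORE-NORMALISED `ρ` ON `T`**: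
`Φ([t], f; m) = ∫_{G⧸T} f(x t x⁻¹) d(ν∕ρ)` (★ D-S1g `classOrbitalIntegral_mk_eq_orbitalIntegral'` at the transport of `ρ`, then ★
`orbitalIntegral_eq_integral_descConj_of_centralizer_eq`). [cite: Rogawski1990, §4.3 (4.3.1) p. 43; §4.9 p. 54] [cite: DeitmarEchterhoff2014, Thm. 1.5.3] -/
theorem OrbitalMeasureFamily.IsCanonical.classOrbitalIntegral_mk_eq_integral_descConj
    {P : G → Prop} (hP : ∀ g x : G, P g → P (x * g * x⁻¹)) {ν : Measure G} [IsHaarMeasure ν] [ν.IsMulRightInvariant]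
    {m : OrbitalMeasureFamily G} (hm : m.IsCanonical P ν) {t : G} (hPt : P t)
    (T : Subgroup G) (hTc : IsClosed (T : Set G)) [MeasurableSpace (G ⧸ T)] [BorelSpace (G ⧸ T)]
    (hT : Subgroup.centralizer ({t} : Set G) = T) (hTt : ∀ τ ∈ T, τ * t = t * τ)
    (ρ : Measure ↥T) [IsHaarMeasure ρ] [ρ.IsInvInvariant] (hρ : ρ (compactCore ↥T) = 1) (f : G → E) :
    classOrbitalIntegral m f (ConjClasses.mk t) = ∫ x, descConj t T hTt f x ∂(quotientMeasure T ρ hTc ν) := by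
  haveI hCc : IsClosed ((Subgroup.centralizer ({t} : Set G) : Subgroup G) : Set G) := isClosed_coe_centralizer_singleton t
  haveI : LocallyCompactSpace ↥(Subgroup.centralizer ({t} : Set G)) := hCc.isClosedEmbedding_subtypeVal.locallyCompactSpace
  haveI : LocallyCompactSpace ↥T := hTc.isClosedEmbedding_subtypeVal.locallyCompactSpace
  -- the transport of `ρ` to `Z(t)` along `refl`
  have hHH' : ∀ g : G, (MulEquiv.refl G) g ∈ Subgroup.centralizer ({t} : Set G) ↔ g ∈ T := fun g => by
    rw [MulEquiv.refl_apply, hT]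
  haveI hρt : IsHaarMeasure (Measure.map (subgroupCongrHomeomorph (MulEquiv.refl G) _ _ hHH' continuous_id continuous_id) ρ) :=
    isHaarMeasure_map_subgroupCongrHomeomorph (MulEquiv.refl G) continuous_id continuous_id _ _ hHH' _
  haveI hρti : (Measure.map (subgroupCongrHomeomorph (MulEquiv.refl G) _ _ hHH' continuous_id continuous_id) ρ).IsInvInvariant :=
    isInvInvariant_map_subgroupCongrHomeomorph (MulEquiv.refl G) continuous_id continuous_id _ _ hHH' _
  have hρt1 : Measure.map (subgroupCongrHomeomorph (MulEquiv.refl G) _ _ hHH' continuous_id continuous_id) ρ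
      (compactCore ↥(Subgroup.centralizer ({t} : Set G))) = 1 := by
    rw [map_subgroupCongrHomeomorph_apply_compactCore, hρ]
  rw [hm.classOrbitalIntegral_mk_eq_orbitalIntegral' hP hPt _ hρt1 f,
    orbitalIntegral_eq_integral_descConj_of_centralizer_eq T hTc hT hTt ν _ hρt1 ρ hρ f]

/-- **N6ns-reg-(ii), GENERIC FORM — THE CLASS ORBITAL INTEGRAL OF A CANONICAL FAMILY IS LOCALLY CONSTANT IN CHART COORDINATES.** `m` canonical for the
conjugation-invariant predicate `P` and the Haar `ν`; `T ≤ G` closed with a core-normalised Haar inversion-invariant `ρ`; `V` a set of `P`-points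
with `Z(t) = T` for `t ∈ V`; chart saturation (SAT) on `V`; `f = 0` off `Ω`. If `f(s t s⁻¹) = f(s t₀ s⁻¹)` for all `s ∈ S` (`t, t₀ ∈ V`), then
`Φ([t], f; m) = Φ([t₀], f; m)`. [cite: HarishChandra1970, Part I §3] [cite: Rogawski1990, §4.3 (4.3.1) p. 43; §4.9 p. 54] -/
theorem OrbitalMeasureFamily.IsCanonical.classOrbitalIntegral_mk_eq_of_forall_conj_eq
    {P : G → Prop} (hP : ∀ g x : G, P g → P (x * g * x⁻¹)) {ν : Measure G} [IsHaarMeasure ν] [ν.IsMulRightInvariant]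
    {m : OrbitalMeasureFamily G} (hm : m.IsCanonical P ν)
    (T : Subgroup G) (hTc : IsClosed (T : Set G)) [MeasurableSpace (G ⧸ T)] [BorelSpace (G ⧸ T)]
    (ρ : Measure ↥T) [IsHaarMeasure ρ] [ρ.IsInvInvariant] (hρ : ρ (compactCore ↥T) = 1)
    (S Ω V : Set G) (hreg : ∀ t ∈ V, P t ∧ Subgroup.centralizer ({t} : Set G) = T)
    (hsat : ∀ t ∈ V, ∀ x : G, x * t * x⁻¹ ∈ Ω → x ∈ S * (T : Set G))
    {f : G → E} (hf : ∀ y ∉ Ω, f y = 0) {t t₀ : G} (ht : t ∈ V) (ht₀ : t₀ ∈ V)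
    (hconst : ∀ s ∈ S, f (s * t * s⁻¹) = f (s * t₀ * s⁻¹)) :
    classOrbitalIntegral m f (ConjClasses.mk t) = classOrbitalIntegral m f (ConjClasses.mk t₀) := by
  have hV : ∀ t ∈ V, ∀ τ ∈ T, τ * t = t * τ := fun t ht τ hτ => by
    rw [← (hreg t ht).2] at hτ
    exact Subgroup.mem_centralizer_singleton_iff.1 hτ
  rw [hm.classOrbitalIntegral_mk_eq_integral_descConj hP (hreg t ht).1 T hTc (hreg t ht).2 (hV t ht) ρ hρ f,
    hm.classOrbitalIntegral_mk_eq_integral_descConj hP (hreg t₀ ht₀).1 T hTc (hreg t₀ ht₀).2 (hV t₀ ht₀) ρ hρ f,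
    integral_descConj_eq_of_forall_conj_eq _ S Ω V hV hsat hf ht ht₀ hconst]

/-- **«vol × g(t)» for a canonical family**: under (SAT), `f = 0` off `Ω` and `f(s t s⁻¹) = c` for `s ∈ S` (`t ∈ V`),
`Φ([t], f; m) = (ν∕ρ)(π(S)) • c` — the quotient measure of the slice image times the torus value. [cite: HarishChandra1970, Part I §3]
[cite: Rogawski1990, §4.3 (4.3.1) p. 43; §4.9 p. 54] -/
theorem OrbitalMeasureFamily.IsCanonical.classOrbitalIntegral_mk_eq_measureReal_smul_of_forall_conj_eq
    {P : G → Prop} (hP : ∀ g x : G, P g → P (x * g * x⁻¹)) {ν : Measure G} [IsHaarMeasure ν] [ν.IsMulRightInvariant]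
    {m : OrbitalMeasureFamily G} (hm : m.IsCanonical P ν)
    (T : Subgroup G) (hTc : IsClosed (T : Set G)) [MeasurableSpace (G ⧸ T)] [BorelSpace (G ⧸ T)]
    (ρ : Measure ↥T) [IsHaarMeasure ρ] [ρ.IsInvInvariant] (hρ : ρ (compactCore ↥T) = 1)
    (S Ω V : Set G) (hreg : ∀ t ∈ V, P t ∧ Subgroup.centralizer ({t} : Set G) = T)
    (hsat : ∀ t ∈ V, ∀ x : G, x * t * x⁻¹ ∈ Ω → x ∈ S * (T : Set G))
    [CompleteSpace E] {f : G → E} (hf : ∀ y ∉ Ω, f y = 0) {t : G} (ht : t ∈ V) {c : E} (hprod : ∀ s ∈ S, f (s * t * s⁻¹) = c)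
    (hSm : MeasurableSet (QuotientGroup.mk '' S : Set (G ⧸ T))) :
    classOrbitalIntegral m f (ConjClasses.mk t) = (quotientMeasure T ρ hTc ν).real (QuotientGroup.mk '' S : Set (G ⧸ T)) • c := by
  have hV : ∀ t ∈ V, ∀ τ ∈ T, τ * t = t * τ := fun t ht τ hτ => by
    rw [← (hreg t ht).2] at hτ
    exact Subgroup.mem_centralizer_singleton_iff.1 hτ
  rw [hm.classOrbitalIntegral_mk_eq_integral_descConj hP (hreg t ht).1 T hTc (hreg t ht).2 (hV t ht) ρ hρ f,
    integral_descConj_eq_measureReal_smul_of_forall_conj_eq _ S Ω V hV hsat hf ht hprod hSm]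

end Canonical

end Literature.NumberTheory.Automorphic

end
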